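import Mathlib
import Literature.Analysis.FluidPDE.ClassicalSolutionCalculus

/-!
# Route PlaneEnergyCeiling · crux `PlanarEnergyAPriori` — time integration of a weighted energy

Helper file for the crux item stmt-NavierStokesRegularity-16855 (`PlanarEnergyAPriori`, route
`PlaneEnergyCeiling`), landed `--supports` that item; shared infrastructure for the line `birth`
(the Gaussian-weighted Duhamel argument of `stub_slabLawMild`, seat 3, uses a TIME-DEPENDENT
weight `W(τ,x) = G_{ν(t+ε−τ)}(c − x₂)`; the signed flux ledger uses a time-independent smoothed
Heaviside `W(τ,x) = g(x₂)`).

**Statement** (`integral_Ioo_integral_weightedEnergy_deriv`). Let `w` be jointly smooth on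
`[0,T] × E` (`IsSmoothSpaceTimeOn (Icc 0 T) w`, e.g. the velocity of a classical solution), and
let `W, W' : ℝ → E → ℝ` be a weight and its time derivative: both jointly continuous on
`[0,T] × E`, with `∂_τ W(τ,x) = W'(τ,x)` at interior times. If the density
`D(τ,x) = W'(τ,x)‖w(τ,x)‖² + W(τ,x)·2⟪∂_τw, w⟫` has finite iterated integral
`∫_{(s,t)}∫‖D‖ < ∞` and the weighted energies `x ↦ W(r,x)‖w(r,x)‖²` are integrable for `r = s, t`,
then for `0 ≤ s ≤ t ≤ T`

  `∫_{(s,t)} ∫ D(τ,x) dx dτ = ∫ W(t,x)‖w(t,x)‖² dx − ∫ W(s,x)‖w(s,x)‖² dx`.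

No compact support and no pointwise decay is assumed: integrability enters only through the two
displayed hypotheses (Tonelli form), so the lemma serves pointwise-decay AND Sobolev-class users.
Proof: Fubini on `(s,t) × E` (accepted `integrable_prod_of_continuousOn_of_lintegral`) and the
fundamental theorem of calculus on every time line (the time derivative of a jointly smooth field
is the accepted `timeDerivWithin`, jointly smooth by `IsSmoothSpaceTimeOn.timeDerivWithin`); the
pattern of the accepted `IsSmoothSpaceTimeOn.integral_Ioo_integral_mul_inner_timeDerivWithin`
(compactly supported weights) with the support hypothesis replaced by integrability. Folklore.
-/

noncomputable section

-- single-conjunct summit: `Summit.<Summit>.<Problem>` repeats the name by the D-0017 layout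
set_option linter.dupNamespace false

namespace Summit.NavierStokesRegularity.NavierStokesRegularity.Theorems.PlanarEnergyAPriori

open MeasureTheory Set Filter Topology Function
open scoped ENNReal RealInnerProductSpace
open Literature.Analysis.FluidPDE

variable {E : Type*} [NormedAddCommGroup E] [InnerProductSpace ℝ E] [FiniteDimensional ℝ E]
  [MeasurableSpace E] [BorelSpace E]
variable {F' : Type*} [NormedAddCommGroup F'] [InnerProductSpace ℝ F']

omit [FiniteDimensional ℝ E] [MeasurableSpace E] [BorelSpace E] in
/-- **FTC on one time line for a weighted squared norm.** For `w` jointly smooth on `[0,T] × E`,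
a weight `W(·,x)` continuous on `[s,t]` with derivative `W'(τ,x)` at interior times, and
`0 ≤ s ≤ t ≤ T`:
`∫_{(s,t)} (W'‖w‖² + W·2⟪∂_τw, w⟫)(τ,x) dτ = W(t,x)‖w(t,x)‖² − W(s,x)‖w(s,x)‖²`. -/
theorem integral_Ioo_weightedEnergy_deriv_line {T : ℝ} {w : ℝ → E → F'} (hw : IsSmoothSpaceTimeOn (Icc 0 T) w)
    (hT : 0 < T) {W W' : ℝ → E → ℝ}
    (hWc : ContinuousOn (uncurry W) (Icc 0 T ×ˢ univ)) (hWsc : ContinuousOn (uncurry W') (Icc 0 T ×ˢ univ))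
    (hWd : ∀ τ ∈ Ioo 0 T, ∀ x, HasDerivAt (fun σ => W σ x) (W' τ x) τ)
    {s t : ℝ} (hs : 0 ≤ s) (hst : s ≤ t) (ht : t ≤ T) (x : E) :
    ∫ τ in Ioo s t, (W' τ x * ‖w τ x‖ ^ 2 + W τ x * (2 * ⟪timeDerivWithin (Icc 0 T) w τ x, w τ x⟫)) =
      W t x * ‖w t x‖ ^ 2 - W s x * ‖w s x‖ ^ 2 := by
  have hU : UniqueDiffOn ℝ (Icc 0 T) := uniqueDiffOn_Icc hT
  have hu_cont : ContinuousOn (uncurry w) (Icc 0 T ×ˢ univ) := hw.continuousOn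
  have hdt_cont : ContinuousOn (uncurry (timeDerivWithin (Icc 0 T) w)) (Icc 0 T ×ˢ univ) :=
    (hw.timeDerivWithin hU).continuousOn
  rcases eq_or_lt_of_le hst with rfl | hst'
  · simp
  -- the slice maps along the time line through `x`
  have hlineI : ∀ {G : ℝ × E → ℝ}, ContinuousOn G (Icc 0 T ×ˢ univ) →
      ContinuousOn (fun τ => G (τ, x)) (Icc s t) := fun hG =>
    hG.comp (Continuous.prodMk_left x).continuousOn fun τ hτ =>
      mk_mem_prod (Icc_subset_Icc hs ht hτ) (mem_univ x)
  have hcW : ContinuousOn (fun τ => W τ x) (Icc s t) := hlineI (G := uncurry W) hWc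
  have hcW' : ContinuousOn (fun τ => W' τ x) (Icc s t) := hlineI (G := uncurry W') hWsc
  have hcw : ContinuousOn (fun τ => w τ x) (Icc s t) := by
    have := hu_cont.comp (Continuous.prodMk_left x).continuousOn fun τ hτ =>
      mk_mem_prod (Icc_subset_Icc hs ht hτ) (mem_univ x)
    exact this
  have hcdw : ContinuousOn (fun τ => timeDerivWithin (Icc 0 T) w τ x) (Icc s t) := by
    have := hdt_cont.comp (Continuous.prodMk_left x).continuousOn fun τ hτ =>
      mk_mem_prod (Icc_subset_Icc hs ht hτ) (mem_univ x)
    exact this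
  have hcont : ContinuousOn (fun τ => W τ x * ‖w τ x‖ ^ 2) (Icc s t) := hcW.mul (hcw.norm.pow 2)
  have hderiv : ∀ τ ∈ Ioo s t, HasDerivAt (fun τ => W τ x * ‖w τ x‖ ^ 2)
      (W' τ x * ‖w τ x‖ ^ 2 + W τ x * (2 * ⟪timeDerivWithin (Icc 0 T) w τ x, w τ x⟫)) τ := by
    intro τ hτ
    have hτ0 : τ ∈ Ioo 0 T := ⟨hs.trans_lt hτ.1, hτ.2.trans_le ht⟩
    have hu' : HasDerivAt (fun σ => w σ x) (timeDerivWithin (Icc 0 T) w τ x) τ :=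
      (hw.hasDerivWithinAt_timeDerivWithin hU (Ioo_subset_Icc_self hτ0) x).hasDerivAt
        (Icc_mem_nhds hτ0.1 hτ0.2)
    have hsq := hu'.norm_sq
    have h := (hWd τ hτ0 x).mul hsq
    refine h.congr_deriv ?_
    rw [real_inner_comm]
  have hint : IntervalIntegrable (fun τ => W' τ x * ‖w τ x‖ ^ 2 +
      W τ x * (2 * ⟪timeDerivWithin (Icc 0 T) w τ x, w τ x⟫)) volume s t := by
    refine ContinuousOn.intervalIntegrable ?_
    rw [uIcc_of_le hst]
    exact (hcW'.mul (hcw.norm.pow 2)).add (hcW.mul (continuousOn_const.mul (hcdw.inner hcw)))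
  have := intervalIntegral.integral_eq_sub_of_hasDerivAt_of_le hst hcont hderiv hint
  rw [intervalIntegral.integral_of_le hst, integral_Ioc_eq_integral_Ioo] at this
  exact this

/-- **Time integration of a weighted energy.** For `w` jointly smooth on `[0,T] × E`, a weight
`W` with time derivative `W'` (both jointly continuous on `[0,T] × E`, `∂_τW = W'` at interior
times), and `0 ≤ s ≤ t ≤ T`: if the density
`D(τ,x) = W'(τ,x)‖w(τ,x)‖² + W(τ,x)·2⟪∂_τw, w⟫` satisfies `∫_{(s,t)}∫ ‖D‖ₑ < ∞` and the weighted
energies at the two ends are integrable, then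
`∫_{(s,t)} ∫ D dx dτ = ∫ W(t,·)‖w(t,·)‖² − ∫ W(s,·)‖w(s,·)‖²`.
(Fubini over `(s,t) × E`, then the fundamental theorem of calculus on every time line.) [folklore] -/
theorem integral_Ioo_integral_weightedEnergy_deriv {T : ℝ} {w : ℝ → E → F'} (hw : IsSmoothSpaceTimeOn (Icc 0 T) w)
    (hT : 0 < T) {W W' : ℝ → E → ℝ}
    (hWc : ContinuousOn (uncurry W) (Icc 0 T ×ˢ univ)) (hWsc : ContinuousOn (uncurry W') (Icc 0 T ×ˢ univ))
    (hWd : ∀ τ ∈ Ioo 0 T, ∀ x, HasDerivAt (fun σ => W σ x) (W' τ x) τ)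
    {s t : ℝ} (hs : 0 ≤ s) (hst : s ≤ t) (ht : t ≤ T)
    (hfin : ∫⁻ τ in Ioo s t, ∫⁻ x, ‖W' τ x * ‖w τ x‖ ^ 2 +
      W τ x * (2 * ⟪timeDerivWithin (Icc 0 T) w τ x, w τ x⟫)‖ₑ < ∞)
    (hIs : Integrable fun x => W s x * ‖w s x‖ ^ 2) (hIt : Integrable fun x => W t x * ‖w t x‖ ^ 2) :
    ∫ τ in Ioo s t, ∫ x, (W' τ x * ‖w τ x‖ ^ 2 + W τ x * (2 * ⟪timeDerivWithin (Icc 0 T) w τ x, w τ x⟫)) =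
      (∫ x, W t x * ‖w t x‖ ^ 2) - ∫ x, W s x * ‖w s x‖ ^ 2 := by
  have hU : UniqueDiffOn ℝ (Icc 0 T) := uniqueDiffOn_Icc hT
  have hu_cont : ContinuousOn (uncurry w) (Icc 0 T ×ˢ univ) := hw.continuousOn
  have hdt_cont : ContinuousOn (uncurry (timeDerivWithin (Icc 0 T) w)) (Icc 0 T ×ˢ univ) :=
    (hw.timeDerivWithin hU).continuousOn
  have hsub : Icc s t ×ˢ (univ : Set E) ⊆ Icc 0 T ×ˢ univ := prod_mono (Icc_subset_Icc hs ht) Subset.rfl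
  -- the density as a function on `ℝ × E`
  set D : ℝ × E → ℝ := fun z => W' z.1 z.2 * ‖w z.1 z.2‖ ^ 2 +
    W z.1 z.2 * (2 * ⟪timeDerivWithin (Icc 0 T) w z.1 z.2, w z.1 z.2⟫) with hD
  have hDcont : ContinuousOn D (Icc s t ×ˢ univ) := by
    have h1 : ContinuousOn (uncurry W') (Icc s t ×ˢ univ) := hWsc.mono hsub
    have h2 : ContinuousOn (uncurry W) (Icc s t ×ˢ univ) := hWc.mono hsub
    have h3 : ContinuousOn (uncurry w) (Icc s t ×ˢ univ) := hu_cont.mono hsub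
    have h4 : ContinuousOn (uncurry (timeDerivWithin (Icc 0 T) w)) (Icc s t ×ˢ univ) := hdt_cont.mono hsub
    exact (h1.mul (h3.norm.pow 2)).add (h2.mul (continuousOn_const.mul (h4.inner h3)))
  have hDint := integrable_prod_of_continuousOn_of_lintegral hDcont (by simpa [hD] using hfin)
  have hswap := integral_integral_swap (f := fun τ x => D (τ, x)) hDint
  simp only [hD] at hswap
  rw [hswap]
  have hline : ∀ x, ∫ τ in Ioo s t, (W' τ x * ‖w τ x‖ ^ 2 +
      W τ x * (2 * ⟪timeDerivWithin (Icc 0 T) w τ x, w τ x⟫)) = W t x * ‖w t x‖ ^ 2 - W s x * ‖w s x‖ ^ 2 :=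
    fun x => integral_Ioo_weightedEnergy_deriv_line hw hT hWc hWsc hWd hs hst ht x
  rw [integral_congr_ae (Eventually.of_forall hline), integral_sub hIt hIs]

/-- **Time-independent weights.** For `w` jointly smooth on `[0,T] × E`, a continuous weight
`g : E → ℝ`, and `0 ≤ s ≤ t ≤ T`: if `∫_{(s,t)}∫ ‖g·2⟪∂_τw, w⟫‖ₑ < ∞` and `g‖w(r,·)‖²` is
integrable for `r = s, t`, then
`∫_{(s,t)} ∫ g(x)·2⟪∂_τw, w⟫ dx dτ = ∫ g‖w(t,·)‖² − ∫ g‖w(s,·)‖²` — the time-integrated form of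
`d/dτ ∫ g|w|² = ∫ g·2⟪∂_τ w, w⟫` used by the signed flux ledger (smoothed Heaviside `g(x) = h(x₂)`).
[folklore] -/
theorem integral_Ioo_integral_weight_mul_inner_timeDeriv {T : ℝ} {w : ℝ → E → F'} (hw : IsSmoothSpaceTimeOn (Icc 0 T) w)
    (hT : 0 < T) {g : E → ℝ} (hg : Continuous g)
    {s t : ℝ} (hs : 0 ≤ s) (hst : s ≤ t) (ht : t ≤ T)
    (hfin : ∫⁻ τ in Ioo s t, ∫⁻ x, ‖g x * (2 * ⟪timeDerivWithin (Icc 0 T) w τ x, w τ x⟫)‖ₑ < ∞)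
    (hIs : Integrable fun x => g x * ‖w s x‖ ^ 2) (hIt : Integrable fun x => g x * ‖w t x‖ ^ 2) :
    ∫ τ in Ioo s t, ∫ x, g x * (2 * ⟪timeDerivWithin (Icc 0 T) w τ x, w τ x⟫) =
      (∫ x, g x * ‖w t x‖ ^ 2) - ∫ x, g x * ‖w s x‖ ^ 2 := by
  have h := integral_Ioo_integral_weightedEnergy_deriv hw hT (W := fun _ x => g x) (W' := fun _ _ => 0)
    ((hg.comp continuous_snd).continuousOn) continuousOn_const
    (fun τ _ x => hasDerivAt_const τ (g x)) hs hst ht (by simpa using hfin) hIs hIt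
  simpa using h

/-- **Time integration of a weighted energy, registered form** (sub-goal
`weightedEnergy_timeIntegration` of stmt-NavierStokesRegularity-16855; shared by the mild slab law
and the flux ledger): `∫_{(s,t)}∫ (W'‖w‖² + W·2⟪∂_τw, w⟫) = ∫ W(t)‖w(t)‖² − ∫ W(s)‖w(s)‖²` under
joint smoothness of `w`, joint continuity of `W, W'` with `∂_τW = W'` inside, a finite iterated
`lintegral` of the density and integrability of the two end energies. [folklore] -/
theorem weightedEnergy_timeIntegration : ∀ {E : Type*} [NormedAddCommGroup E] [InnerProductSpace ℝ E] [FiniteDimensional ℝ E] [MeasurableSpace E] [BorelSpace E] {F' : Type*} [NormedAddCommGroup F'] [InnerProductSpace ℝ F'] {T : ℝ} {w : ℝ → E → F'}, Literature.Analysis.FluidPDE.IsSmoothSpaceTimeOn (Set.Icc 0 T) w → 0 < T → ∀ {W W' : ℝ → E → ℝ}, ContinuousOn (Function.uncurry W) (Set.Icc 0 T ×ˢ Set.univ) → ContinuousOn (Function.uncurry W') (Set.Icc 0 T ×ˢ Set.univ) → (∀ τ ∈ Set.Ioo 0 T, ∀ x, HasDerivAt (fun σ => W σ x) (W' τ x)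 τ) → ∀ {s t : ℝ}, 0 ≤ s → s ≤ t → t ≤ T → ∫⁻ τ in Set.Ioo s t, ∫⁻ x, ‖W' τ x * ‖w τ x‖ ^ 2 + W τ x * (2 * inner ℝ (Literature.Analysis.FluidPDE.timeDerivWithin (Set.Icc 0 T) w τ x) (w τ x))‖ₑ < ⊤ → MeasureTheory.Integrable (fun x => W s x * ‖w s x‖ ^ 2) → MeasureTheory.Integrable (fun x => W t x * ‖w t x‖ ^ 2) → ∫ τ in Set.Ioo s t, ∫ x, (W' τ x * ‖w τ x‖ ^ 2 + W τ x * (2 * inner ℝ (Literature.Analysis.FluidPDE.timeDerivWithin (Set.Icc 0 T) w τ x) (w τ x))) = (∫ x, W t x * ‖w t x‖ ^ 2) - ∫ x, W s x * ‖w s x‖ ^ 2 :=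
  fun hw hT _ _ hWc hWsc hWd _ _ hs hst ht hfin hIs hIt =>
    integral_Ioo_integral_weightedEnergy_deriv hw hT hWc hWsc hWd hs hst ht hfin hIs hIt

end Summit.NavierStokesRegularity.NavierStokesRegularity.Theorems.PlanarEnergyAPriori

end
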